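import Mathlib

/-!
# The two-branch sign lemma behind the sink case of row 2′DARC (blind cell PercRepro2, night-2)

Pure algebra in an ordered field (proofs/NIGHT2-DARC.md §8). Masses of a system `D₀` on three nested
avoidance events `𝒟₁ ⊇ 𝒟₂ ⊇ 𝒟₃`: `P_i = P(𝒟_i)`, `A_i = E[X; 𝒟_i]`, `B_i = E[Y; 𝒟_i]`, `C_i = E[XY; 𝒟_i]`.
A coin event of probability `c` (closed) / `c′` (open) splits the conditioning event `R` into the
branches `𝒟₁` (coin closed) and `𝒟₂` (coin open) and the gate event into `𝒟₁` and `𝒟₃`, so that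
`P(R) = cP₁ + c′P₂`, `E[X; R] = cA₁ + c′A₂`, …, `P(gate) = cP₁ + c′P₃`, `E[XY; gate] = cC₁ + c′C₃`.
If the conditional covariances on `𝒟₁` and `𝒟₃` are nonnegative and the conditional means are
ordered along the chain (cleared forms), the cleared gate functional
`P(R)²·E[XY; gate] − P(R)E[X; R]E[Y; gate] − P(R)E[Y; R]E[X; gate] + E[X; R]E[Y; R]P(gate)` is
nonnegative: the global centring lies between the means of `𝒟₁` and `𝒟₂`, hence above the mean of
`𝒟₃`, so both branch shift products have a sign (`sink_alg`). Used by `CoinSink.lean`.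
-/

namespace Summit.Ventures.PercRepro2.Coin

/-! ## The two-branch sign lemma (pure algebra) -/

section Alg

variable {R : Type*} [Field R]

/-- One branch of the sink decomposition, cleared by `P₁`. -/
lemma branch_identity (P A B P₁ A₁ B₁ C₁ : R) :
    P₁ * (P ^ 2 * C₁ - P * A * B₁ - P * B * A₁ + A * B * P₁) =
      P ^ 2 * (P₁ * C₁ - A₁ * B₁) + (P * A₁ - A * P₁) * (P * B₁ - B * P₁) := by ring

variable [LinearOrder R] [IsStrictOrderedRing R]

/-- A branch with nonnegative covariance and shifts of a common sign has a nonnegative cleared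
functional. -/
lemma branch_nonneg {P A B P₁ A₁ B₁ C₁ : R} (hP₁ : 0 < P₁) (hcov : A₁ * B₁ ≤ P₁ * C₁)
    (hsign : 0 ≤ (P * A₁ - A * P₁) * (P * B₁ - B * P₁)) :
    0 ≤ P ^ 2 * C₁ - P * A * B₁ - P * B * A₁ + A * B * P₁ := by
  have h := branch_identity P A B P₁ A₁ B₁ C₁
  have h2 : 0 ≤ P ^ 2 * (P₁ * C₁ - A₁ * B₁) := mul_nonneg (sq_nonneg P) (by linarith)
  have h3 : 0 ≤ P₁ * (P ^ 2 * C₁ - P * A * B₁ - P * B * A₁ + A * B * P₁) := by rw [h]; linarith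
  exact (mul_nonneg_iff_of_pos_left hP₁).mp h3

/-- **The two-branch sign lemma.** Masses on three nested avoidance events `𝒟₁ ⊇ 𝒟₂ ⊇ 𝒟₃` of a
system `D₀` (`P_i, A_i, B_i, C_i`), a coin event of mass `c` (closed) / `c′` (open): if the covariances
on `𝒟₁`, `𝒟₃` are nonnegative and the conditional means decrease along the chain, the cleared gate
functional `P(R)²E[XY;𝓔] − P(R)E[X;R]E[Y;𝓔] − P(R)E[Y;R]E[X;𝓔] + E[X;R]E[Y;R]P(𝓔)` with
`R = c𝒟₁ + c′𝒟₂`, `𝓔 = c𝒟₁ + c′𝒟₃` is nonnegative. -/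
theorem sink_alg {P₁ P₂ P₃ A₁ A₂ A₃ B₁ B₂ B₃ C₁ C₃ c c' : R}
    (hP₁ : 0 < P₁) (hP₂ : 0 < P₂) (hP₃ : 0 < P₃) (hc : 0 ≤ c) (hc' : 0 ≤ c')
    (hcov₁ : A₁ * B₁ ≤ P₁ * C₁) (hcov₃ : A₃ * B₃ ≤ P₃ * C₃)
    (hA₁₂ : A₂ * P₁ ≤ A₁ * P₂) (hA₂₃ : A₃ * P₂ ≤ A₂ * P₃)
    (hB₁₂ : B₂ * P₁ ≤ B₁ * P₂) (hB₂₃ : B₃ * P₂ ≤ B₂ * P₃) :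
    0 ≤ (c * P₁ + c' * P₂) ^ 2 * (c * C₁ + c' * C₃)
        - (c * P₁ + c' * P₂) * (c * A₁ + c' * A₂) * (c * B₁ + c' * B₃)
        - (c * P₁ + c' * P₂) * (c * B₁ + c' * B₂) * (c * A₁ + c' * A₃)
        + (c * A₁ + c' * A₂) * (c * B₁ + c' * B₂) * (c * P₁ + c' * P₃) := by
  set P := c * P₁ + c' * P₂ with hP
  set A := c * A₁ + c' * A₂ with hA
  set B := c * B₁ + c' * B₂ with hB
  have hA₁₃ : A₃ * P₁ ≤ A₁ * P₃ := by
    have h1 : A₃ * P₂ * P₁ ≤ A₂ * P₃ * P₁ := mul_le_mul_of_nonneg_right hA₂₃ hP₁.le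
    have h2 : A₂ * P₁ * P₃ ≤ A₁ * P₂ * P₃ := mul_le_mul_of_nonneg_right hA₁₂ hP₃.le
    have h3 : A₃ * P₁ * P₂ ≤ A₁ * P₃ * P₂ := by nlinarith
    exact le_of_mul_le_mul_right h3 hP₂
  have hB₁₃ : B₃ * P₁ ≤ B₁ * P₃ := by
    have h1 : B₃ * P₂ * P₁ ≤ B₂ * P₃ * P₁ := mul_le_mul_of_nonneg_right hB₂₃ hP₁.le
    have h2 : B₂ * P₁ * P₃ ≤ B₁ * P₂ * P₃ := mul_le_mul_of_nonneg_right hB₁₂ hP₃.le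
    have h3 : B₃ * P₁ * P₂ ≤ B₁ * P₃ * P₂ := by nlinarith
    exact le_of_mul_le_mul_right h3 hP₂
  have s₁A : 0 ≤ P * A₁ - A * P₁ := by
    have : P * A₁ - A * P₁ = c' * (P₂ * A₁ - A₂ * P₁) := by rw [hP, hA]; ring
    rw [this]; exact mul_nonneg hc' (by linarith)
  have s₁B : 0 ≤ P * B₁ - B * P₁ := by
    have : P * B₁ - B * P₁ = c' * (P₂ * B₁ - B₂ * P₁) := by rw [hP, hB]; ring
    rw [this]; exact mul_nonneg hc' (by linarith)
  have br₁ : 0 ≤ P ^ 2 * C₁ - P * A * B₁ - P * B * A₁ + A * B * P₁ :=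
    branch_nonneg hP₁ hcov₁ (mul_nonneg s₁A s₁B)
  have s₃A : P * A₃ - A * P₃ ≤ 0 := by
    have : P * A₃ - A * P₃ = c * (P₁ * A₃ - A₁ * P₃) + c' * (P₂ * A₃ - A₂ * P₃) := by
      rw [hP, hA]; ring
    rw [this]
    have h1 : c * (P₁ * A₃ - A₁ * P₃) ≤ 0 := mul_nonpos_of_nonneg_of_nonpos hc (by linarith)
    have h2 : c' * (P₂ * A₃ - A₂ * P₃) ≤ 0 := mul_nonpos_of_nonneg_of_nonpos hc' (by linarith)
    linarith
  have s₃B : P * B₃ - B * P₃ ≤ 0 := by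
    have : P * B₃ - B * P₃ = c * (P₁ * B₃ - B₁ * P₃) + c' * (P₂ * B₃ - B₂ * P₃) := by
      rw [hP, hB]; ring
    rw [this]
    have h1 : c * (P₁ * B₃ - B₁ * P₃) ≤ 0 := mul_nonpos_of_nonneg_of_nonpos hc (by linarith)
    have h2 : c' * (P₂ * B₃ - B₂ * P₃) ≤ 0 := mul_nonpos_of_nonneg_of_nonpos hc' (by linarith)
    linarith
  have br₃ : 0 ≤ P ^ 2 * C₃ - P * A * B₃ - P * B * A₃ + A * B * P₃ :=
    branch_nonneg hP₃ hcov₃ (mul_nonneg_of_nonpos_of_nonpos s₃A s₃B)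
  have htot : P ^ 2 * (c * C₁ + c' * C₃) - P * A * (c * B₁ + c' * B₃) - P * B * (c * A₁ + c' * A₃)
      + A * B * (c * P₁ + c' * P₃)
      = c * (P ^ 2 * C₁ - P * A * B₁ - P * B * A₁ + A * B * P₁)
        + c' * (P ^ 2 * C₃ - P * A * B₃ - P * B * A₃ + A * B * P₃) := by ring
  rw [htot]
  exact add_nonneg (mul_nonneg hc br₁) (mul_nonneg hc' br₃)

end Alg

end Summit.Ventures.PercRepro2.Coin
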